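import Literature.AlgebraicGeometry.Frobenioids.ArchimedeanSlimLift
import Literature.AlgebraicGeometry.Frobenioids.ArchimedeanUnitStabilizers
import Literature.AlgebraicGeometry.Frobenioids.ArchimedeanBasicProperties
import Literature.AlgebraicGeometry.Frobenioids.ArchimedeanSlitRegion
import HarnessLib

/-!
# Frobenioids II, Theorem 3.6 (x): "if `D` is slim and `Λ ∈ {ℤ, ℝ}`, then `F` is slim" — PROVED for
# `F = C = C^ℤ` over any base `π : D → D₀`

Mochizuki, *The geometry of Frobenioids II: poly-Frobenioids*, Kyushu J. Math. **62** (2008)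
401–460, §3, Theorem 3.6 (x), author's kurims text p. 38 [cite: MochizukiFrdII2008, Thm 3.6 (x) p.38]:
"(x) If `D` is slim, and `Λ ∈ {ℤ, ℝ}`, then `F` is also slim." Printed proof (p. 38): "Assertion (x)
follows formally from [FrdI], Proposition 1.13, (iii) (since, by assertions (v) and (vii) of the
present Theorem 3.6, either 'condition (a)' or 'condition (b)' of loc. cit. is always satisfied by
objects of `F`)." [cite: MochizukiFrdI2008, Prop. 1.13 (iii) pp.39-40]

PROOF-ONLY companion (abc-iut cell, layer L1, seat abc-iut-L6-d7; PIECE 3 of abc-iut-L1-t9's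
PIECES 2026-08-25T21:10:12Z / abc-iut-L1-lead (gen 2) 21:10:34Z): `ArchFrd.Slim.thm36x_C :
Thm36x MonoidType.Z D (C π)` — EXACTLY abc-iut-L1-t9's schema `ArchFrd.Thm36x`
(`ArchimedeanBasicProperties.lean`) at `Λ = ℤ`, `D' = D`, `X' = C π` (abc-iut-L1-t6's Example 3.3,
`AngularFrobenioidsRelative.lean`), i.e. `IsSlim D → ℤ ≠ ℚ → IsSlim (C π)`; and the vacuous instance
`thm36x_Q` (`Λ = ℚ` is excluded by the schema's hypothesis). The proof follows print through the model:
Step 1 (`ArchimedeanSlimLift.lean`, [FrdI] Prop. 1.13 (i)): a natural automorphism `α` of `C_A → C`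
lies over the identity of `D`; Step 2: hence each component `α_f ∈ O^×(B)` (`f : B → A`); Step 3:
`α_f = id` — for `B` complex non-isotropic because `O^×(B) = {1}` (Thm. 3.6 (v) (a),
`ArchimedeanUnitStabilizers.lean`); for `B` complex isotropic by naturality along the isometric
pre-step `B^slit → B` from the (non-isotropic) slit object ([FrdI] Prop. 1.13 (iii) condition (a));
for `B` real (`O^×(B) = {±1}`) by naturality along the degree-`2` Frobenius endomorphism
`((id, 2, λ⁻¹), id)` of `B`, which squares the scalar (condition (b): `⋂ₙ O^×(B)ⁿ = {1}`).
The case `Λ = ℝ` of the printed statement concerns the realification `C^rlf`, typed in the tree only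
as the uninterpreted interface `LambdaCompletion` — not a statement about a constructed category, so
not discharged here (reported to abc-iut-L1-t9). Small constructions only (`slitObj`, `slitIncl`,
`frobTwo`); no new notion; nothing printed is strengthened; nothing here bears on [IUTchIII] Cor 3.12.
-/

namespace Literature.AlgebraicGeometry.Frobenioids

open CategoryTheory Set
open scoped Pointwise

universe v u

namespace ArchFrd

namespace Slim

section Units

variable {D : Type u} [Category.{v} D] (π : D ⥤ D0)

/-! ### Step 2: the components are units `((id, 1, c), id)` -/

/-- The `C₀`-part of an isomorphism of `C` has Frobenius degree `1`. [cite: MochizukiFrdII2008, Thm 3.6 (x) p.38] -/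
theorem degFr_fst_eq_one {B B' : C π} (u : B ≅ B') : C0.degFr u.hom.fst = 1 := by
  have h := congrArg (fun φ => C0.degFr (CFP.Hom.fst φ)) u.hom_inv_id
  change C0.degFr (u.hom.fst ≫ u.inv.fst) = C0.degFr (𝟙 B.fst) at h
  rw [C0.degFr_comp', C0.degFr_id'] at h
  have h' := congrArg (fun n : ℕ+ => (n : ℕ)) h
  simp only [PNat.mul_coe, PNat.one_coe] at h'
  exact PNat.coe_eq_one_iff.mp (Nat.eq_one_of_mul_eq_one_right h')

/-- **Step 2**: for `D` slim, every component `α_f` (`f : B → A`) of a natural automorphism of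
`C_A → C` is a unit, `α_f ∈ O^×(B)` ([FrdI] Prop. 1.13 (iii), first sentence of its proof).
[cite: MochizukiFrdI2008, Prop. 1.13 (iii) pp.39-40] -/
theorem app_mem_unitsSubgroup (hD : IsSlim D) (A : C π) (α : Over.forget A ≅ Over.forget A)
    (f : Over A) : α.app f ∈ PreFrobenioid.unitsSubgroup (C.toElem π) f.left :=
  ⟨snd_app_eq_id π hD A α f, degFr_fst_eq_one π (α.app f)⟩

/-! ### Step 3 (a): complex isotropic objects — test against the slit object (an isometric pre-step
from a NON-isotropic object, [FrdI] Prop. 1.13 (iii) (a) via Thm. 3.6 (v), (vii)) -/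

/-- The SLIT OBJECT under a complex `B ∈ Ob(C)`: same base, same tip, angular part `S¹ ∖ {−1}`
(abc-iut-L1-t6's `slitRegion`). [cite: MochizukiFrdII2008, Ex 3.3 (v) p.29] -/
noncomputable abbrev slitObj (B : C π) (hc : B.fst.base = .complex) : C π :=
  ⟨⟨B.fst.base, slitRegion B.fst.region.tip, fun h => by rw [hc] at h; cases h⟩, B.snd, B.iso⟩

/-- The slit object is not naively isotropic. [cite: MochizukiFrdII2008, Ex 3.3 (v) p.29] -/
theorem not_isNaivelyIsotropic_slitObj (B : C π) (hc : B.fst.base = .complex) :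
    ¬ (slitObj π B hc).fst.IsNaivelyIsotropic :=
  not_isIsotropic_slitRegion _

/-- The `C₀`-part `(id, 1, 1)` of the inclusion of the slit object into a naively isotropic `B`.
[cite: MochizukiFrdII2008, Ex 3.3 (v) p.29] -/
noncomputable def slitInclFst (B : C π) (hB : B.fst.IsNaivelyIsotropic) (hc : B.fst.base = .complex) :
    (slitObj π B hc).fst ⟶ B.fst where
  base := 𝟙 B.fst.base
  degFr := 1
  scalar := 1
  scalar_mem := one_mem _
  mapsTo := by
    rw [PNat.one_coe, pow_one, one_smul, C0.pullRegion_id]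
    intro u hu
    rw [C0.mem_carrier_of_isIsotropic hB]
    exact hu.2

/-- The inclusion `B^slit → B` (an isometric pre-step `((id, 1, 1), id)`).
[cite: MochizukiFrdII2008, Ex 3.3 (v) p.29] -/
noncomputable def slitIncl (B : C π) (hB : B.fst.IsNaivelyIsotropic) (hc : B.fst.base = .complex) :
    slitObj π B hc ⟶ B :=
  ⟨slitInclFst π B hB hc, 𝟙 B.snd, by
    change 𝟙 _ ≫ B.iso.hom = B.iso.hom ≫ π.map (𝟙 B.snd)
    rw [CategoryTheory.Functor.map_id, Category.id_comp, Category.comp_id]⟩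

/-- **Step 3 (a)**: at a COMPLEX naively isotropic `B`, the scalar of `α_f` is `1` — by naturality
along `B^slit → B`, whose source has `O^× = {1}` (Thm. 3.6 (v) (a)).
[cite: MochizukiFrdII2008, Thm 3.6 (x) p.38] -/
theorem scalar_app_eq_one_of_complex (hD : IsSlim D) (A : C π) (α : Over.forget A ≅ Over.forget A)
    (f : Over A) (hB : f.left.fst.IsNaivelyIsotropic) (hc : f.left.fst.base = .complex) :
    C0.scalar (α.app f).hom.fst = 1 := by
  let f' : Over A := Over.mk (slitIncl π f.left hB hc ≫ f.hom)
  have hnat : slitIncl π f.left hB hc ≫ (α.app f).hom = (α.app f').hom ≫ slitIncl π f.left hB hc :=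
    α.hom.naturality (Over.homMk (slitIncl π f.left hB hc) rfl : f' ⟶ f)
  have h1 : (α.app f' : Aut f'.left) = (1 : Aut f'.left) :=
    UnitStab.eq_one_of_not_isNaivelyIsotropic π f'.left (not_isNaivelyIsotropic_slitObj π f.left hc)
      (α.app f') (app_mem_unitsSubgroup π hD A α f')
  have h2 : slitIncl π f.left hB hc ≫ (α.app f).hom = slitIncl π f.left hB hc := by
    rw [hnat, h1]
    exact Category.id_comp _
  have h4 := congrArg (fun φ => C0.scalar (CFP.Hom.fst φ)) h2
  change C0.scalar ((slitIncl π f.left hB hc).fst ≫ (α.app f).hom.fst) =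
    C0.scalar (slitIncl π f.left hB hc).fst at h4
  rw [C0.scalar_comp'] at h4
  change D0.Hom.act (𝟙 f.left.fst.base) (C0.scalar (α.app f).hom.fst) *
    1 ^ (C0.degFr (α.app f).hom.fst : ℕ) = 1 at h4
  rwa [act_id, one_pow, mul_one] at h4

/-! ### Step 3 (b): real objects — test against the Frobenius endomorphism of degree `2`
([FrdI] Prop. 1.13 (iii) (b): `⋂ₙ O^×(B)ⁿ = {1}` for `O^×(B) = {±1}`) -/

/-- The `C₀`-endomorphism `(id, 2, λ⁻¹)` of a naively isotropic object with tip `λ` (a base-identity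
endomorphism of Frobenius degree `2`). [cite: MochizukiFrdII2008, Ex 3.3 (ii) p.28] -/
noncomputable def frobTwoFst (B : C0) (hB : B.IsNaivelyIsotropic) : B ⟶ B where
  base := 𝟙 B.base
  degFr := 2
  scalar := (ofPosReal ℂ B.region.tip)⁻¹
  scalar_mem := by
    apply inv_mem
    rcases D0.isReal_or_isComplex B.base with h | h
    · have hr : B.base = .real := h
      rw [hr, D0.mem_scalars_real_iff, coe_ofPosReal]
      exact Complex.ofReal_im _
    · have hc : B.base = .complex := h
      rw [hc, D0.scalars_complex]
      exact Subgroup.mem_top _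
  mapsTo := by
    rw [C0.pullRegion_id]
    rintro _ ⟨w, hw, rfl⟩
    rw [show ((2 : ℕ+) : ℕ) = 2 from rfl, sq] at hw
    obtain ⟨u, hu, v, hv, rfl⟩ := hw
    rw [C0.mem_carrier_of_isIsotropic hB] at hu hv ⊢
    have ht : (0 : ℝ) < B.region.tip := B.region.tip.2
    have hu' : ‖(u : ℂ)‖ ≤ B.region.tip := by rw [← coe_absHom]; exact_mod_cast hu
    have hv' : ‖(v : ℂ)‖ ≤ B.region.tip := by rw [← coe_absHom]; exact_mod_cast hv
    rw [← Subtype.coe_le_coe, coe_absHom]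
    change ‖(((ofPosReal ℂ B.region.tip)⁻¹ * (u * v) : ℂˣ) : ℂ)‖ ≤ B.region.tip
    rw [Units.val_mul, Units.val_inv_eq_inv_val, norm_mul, norm_inv, Units.val_mul, norm_mul,
      coe_ofPosReal, RCLike.norm_ofReal, abs_of_pos ht, inv_mul_le_iff₀ ht]
    exact mul_le_mul hu' hv' (norm_nonneg _) ht.le

/-- The endomorphism `((id, 2, λ⁻¹), id)` of `B ∈ Ob(C)` with naively isotropic `C₀`-component.
[cite: MochizukiFrdII2008, Ex 3.3 (ii) p.28] -/
noncomputable def frobTwo (B : C π) (hB : B.fst.IsNaivelyIsotropic) : B ⟶ B :=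
  ⟨frobTwoFst B.fst hB, 𝟙 B.snd, by
    change 𝟙 _ ≫ B.iso.hom = B.iso.hom ≫ π.map (𝟙 B.snd)
    rw [CategoryTheory.Functor.map_id, Category.id_comp, Category.comp_id]⟩

/-- **Step 3 (b)**: at a REAL `B`, the scalar `c ∈ {±1}` of `α_f` is `1` — by naturality along the
degree-`2` Frobenius endomorphism `ψ` of `B`: `c · λ⁻¹ = λ⁻¹ · c'²` with `c' ∈ {±1}` the scalar of
`α_{ψ;f}`. [cite: MochizukiFrdII2008, Thm 3.6 (x) p.38] -/
theorem scalar_app_eq_one_of_real (hD : IsSlim D) (A : C π) (α : Over.forget A ≅ Over.forget A)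
    (f : Over A) (hr : f.left.fst.base = .real) : C0.scalar (α.app f).hom.fst = 1 := by
  have hB : f.left.fst.IsNaivelyIsotropic := f.left.fst.isIsotropic_of_isReal hr
  let f' : Over A := Over.mk (frobTwo π f.left hB ≫ f.hom)
  have hnat : frobTwo π f.left hB ≫ (α.app f).hom = (α.app f').hom ≫ frobTwo π f.left hB :=
    α.hom.naturality (Over.homMk (frobTwo π f.left hB) rfl : f' ⟶ f)
  have hu' := app_mem_unitsSubgroup π hD A α f'
  have h := congrArg (fun φ => C0.scalar (CFP.Hom.fst φ)) hnat
  change C0.scalar ((frobTwo π f.left hB).fst ≫ (α.app f).hom.fst) =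
    C0.scalar ((α.app f').hom.fst ≫ (frobTwo π f.left hB).fst) at h
  rw [C0.scalar_comp', C0.scalar_comp', UnitStab.base_fst_eq_id π _ (α.app f') hu',
    degFr_fst_eq_one π (α.app f)] at h
  change D0.Hom.act (𝟙 f.left.fst.base) (C0.scalar (α.app f).hom.fst) *
      (ofPosReal ℂ f.left.fst.region.tip)⁻¹ ^ ((1 : ℕ+) : ℕ) =
    D0.Hom.act (𝟙 f.left.fst.base) (ofPosReal ℂ f.left.fst.region.tip)⁻¹ *
      C0.scalar (α.app f').hom.fst ^ ((2 : ℕ+) : ℕ) at h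
  rw [act_id, act_id, PNat.one_coe, pow_one, show ((2 : ℕ+) : ℕ) = 2 from rfl] at h
  -- the scalar `c'` of `α_{f'}` is `±1` (real object), so `c'² = 1`
  have hmem : C0.scalar (α.app f').hom.fst ∈ D0.scalars .real := hr ▸ (α.app f').hom.fst.scalar_mem
  have hsq : C0.scalar (α.app f').hom.fst ^ 2 = 1 := by
    rcases UnitStab.eq_one_or_eq_neg_one_of_mem_scalars_real hmem
      (UnitStab.norm_scalar_eq_one π _ (α.app f') hu') with h1 | h1
    · rw [h1, one_pow]
    · rw [h1, neg_one_sq]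
  rw [hsq, mul_one, mul_comm] at h
  -- h : λ⁻¹ * c = λ⁻¹
  exact mul_left_cancel (h.trans (mul_one _).symm)

/-! ### Theorem 3.6 (x) for `C = C^ℤ` -/

/-- **[FrdI] Prop. 1.13 (iii) for `C`**: for `D` slim, every component of a natural automorphism of
`C_A → C` is the identity. [cite: MochizukiFrdI2008, Prop. 1.13 (iii) pp.39-40] -/
theorem app_eq_one (hD : IsSlim D) (A : C π) (α : Over.forget A ≅ Over.forget A) (f : Over A) :
    (α.app f : Aut f.left) = (1 : Aut f.left) := by
  have hu := app_mem_unitsSubgroup π hD A α f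
  by_cases hX : f.left.fst.IsNaivelyIsotropic
  · have hc : C0.scalar (α.app f).hom.fst = 1 := by
      rcases D0.isReal_or_isComplex f.left.fst.base with hr | hcx
      · exact scalar_app_eq_one_of_real π hD A α f hr
      · exact scalar_app_eq_one_of_complex π hD A α f hX hcx
    exact UnitStab.eq_of_scalar_eq π f.left (α.app f) 1 hu (one_mem _) (by rw [hc]; rfl)
  · exact UnitStab.eq_one_of_not_isNaivelyIsotropic π f.left hX (α.app f) hu

/-- **Theorem 3.6 (x) for `C = C^ℤ`** (PROVED, over any base `π : D → D₀`): "If `D` is slim, and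
`Λ ∈ {ℤ, ℝ}`, then `F` is slim" — the instance `Λ = ℤ`, `F = C`: `D` slim ⇒ `C = C₀ ×_{D₀} D` slim.
This is EXACTLY abc-iut-L1-t9's schema `ArchFrd.Thm36x` at `(MonoidType.Z, D, C π)`.
[cite: MochizukiFrdII2008, Thm 3.6 (x) p.38] -/
theorem thm36x_C : Thm36x MonoidType.Z D (C π) := by
  intro hD _
  refine ⟨fun A α => ?_⟩
  apply Iso.ext
  apply NatTrans.ext
  funext f
  exact congrArg Iso.hom (app_eq_one π hD A α f)

/-- **Theorem 3.6 (x), the case `Λ = ℚ`** is vacuous as typed (`Thm36x` carries the hypothesis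
`Λ ≠ ℚ`): recorded for every category `X'`. [cite: MochizukiFrdII2008, Thm 3.6 (x) p.38] -/
theorem thm36x_Q (X' : Type u) [Category.{v} X'] : Thm36x MonoidType.Q D X' :=
  fun _ h => absurd rfl h

end Units

end Slim

end ArchFrd

end Literature.AlgebraicGeometry.Frobenioids
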